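import Summits.SmoothPoincare4.SmoothPoincare4.Theorems.CongruenceShadowsShadowApproximationStubLayerStepZero
import Summits.SmoothPoincare4.SmoothPoincare4.Theorems.CongruenceShadowsShadowApproximationStubGoeritzRealisationPos
import HarnessLib

/-!
# Helper for stub `stub_layerStepOneZero` (line `nilpotent-genus-class`, crux
`CongruenceShadows.ShadowApproximation`, item stmt-SmoothPoincare4-14595):
# pair normalisation and readings at genus `3 + 3m`

`S = SurfaceGroup (3+3m)`, `N i = s4Kernels.stabilizeIter m i`, `γₖ₊₁ = (⊤).lowerCentralSeries k`,
`H₁ = ℤ^{Fin (3+3m) × Bool}` via `ab = SurfaceGroup.abelianize`, `Λᵢ` the coordinate Lagrangian of slot `i`.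
The genus-`3` ingredients of the landed `stub_layerStepZero` (W5: `…StubLayerStepZeroPair`, `…StubLayerStepZero`)
at every genus `3 + 3m`:

* §1 glue in `H₁` (`span_image_map_g`, `span_image_sup_lcs_g`, `map_Λ_stabilizeIter_of_map_eq`,
  `map_Λ_stabilizeIter_of_map_sup_eq`) and **pair normalisation** `exists_ia_of_pair_stabilizeIter`: granted (AUTSYMP)
  at genus `3+3m`, an `α ∈ Stab N₀` with `α(N₂) = P`, `P γ₂ = N₂ γ₂` is replaced by an IA-automorphism `α'` with
  `α'(N₂) = P` — realising the `±`-isometry of `α` (which stabilises `Λ₀`, `Λ₂`) inside `Stab N₀ ∩ Stab N₂` by the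
  landed coordinate-pair Goeritz realisation `exists_goeritz_realises` (so no realisation HYPOTHESIS is needed here).
* §2 **readings** through the erasing projection `π : S ↠ F = FreeGroup (Fin (3+3m))` of the cut pattern `ct` of slot
  `2` (`ker π = N₂`): `reading_ia_g` (an IA-automorphism reads as an ALTERNATING form `D`, from the landed `reading` +
  `stub_magnusWittRead`), `reading_list_prod_zpow` (a product of powers `∏ ψᵢ ^ nᵢ` of IA-automorphisms with readings
  `Dᵢ` reads as `∑ nᵢ Dᵢ`), and `map_le_of_forms_g` (equal readings on `v < w` ⟹ `ψ(N₂) ≤ φ(N₂) γ₃`: torsor calculus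
  `level_mem_iff` over the honest kernels `φ(N₂)`, no hidden depth, target transport).
No definitions.
-/

set_option linter.dupNamespace false

noncomputable section

open Subgroup Literature.Topology.FourManifolds Literature.Algebra.Lie Multiplicative
open Summit.SmoothPoincare4.SmoothPoincare4.Theorems.NilpotentShadowsStandard.SaturatedTorsorDescent
open scoped commutatorElement

namespace Summit.SmoothPoincare4.SmoothPoincare4.Theorems.ShadowApproximation.NilpotentGenusClass

/-! ## §1 Glue in `H₁` and pair normalisation at genus `3 + 3m` -/

section Glue

variable {g : ℕ}

/-- The image in `H₁` of `P.map ψ` is `F` applied to the image of `P`, when `ψ` induces `F` (any genus). [folklore] -/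
theorem span_image_map_g (ψ : SurfaceGroup g ≃* SurfaceGroup g) (F : (surfaceGen g → ℤ) ≃ₗ[ℤ] (surfaceGen g → ℤ))
    (hF : ∀ s, toAdd (SurfaceGroup.abelianize g (ψ s)) = F (toAdd (SurfaceGroup.abelianize g s)))
    (P : Subgroup (SurfaceGroup g)) :
    Submodule.span ℤ ((fun s => toAdd (SurfaceGroup.abelianize g s)) '' (P.map ψ.toMonoidHom : Set (SurfaceGroup g))) =
      (Submodule.span ℤ ((fun s => toAdd (SurfaceGroup.abelianize g s)) '' (P : Set (SurfaceGroup g)))).map F.toLinearMap := by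
  -- adapted from the landed …StubLayerStepZeroPair (genus 3)
  rw [Submodule.map_span]
  congr 1
  ext v
  constructor
  · rintro ⟨_, ⟨s, hs, rfl⟩, rfl⟩
    exact ⟨toAdd (SurfaceGroup.abelianize g s), ⟨s, hs, rfl⟩, (hF s).symm⟩
  · rintro ⟨_, ⟨s, hs, rfl⟩, rfl⟩
    exact ⟨ψ s, ⟨s, hs, rfl⟩, hF s⟩

/-- `γ₂ = ker ab` is invisible in `H₁` (any genus). [folklore] -/
theorem span_image_sup_lcs_g (P : Subgroup (SurfaceGroup g)) :
    Submodule.span ℤ ((fun s => toAdd (SurfaceGroup.abelianize g s)) ''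
        ((P ⊔ ((⊤ : Subgroup (SurfaceGroup g)).lowerCentralSeries 1) : Subgroup (SurfaceGroup g)) : Set (SurfaceGroup g))) =
      Submodule.span ℤ ((fun s => toAdd (SurfaceGroup.abelianize g s)) '' (P : Set (SurfaceGroup g))) := by
  -- adapted from the landed …StubLayerStepZeroPair (genus 3)
  have h := SurfaceGroup.span_image_sup (g := g) P ((⊤ : Subgroup (SurfaceGroup g)).lowerCentralSeries 1)
  have h0 : Submodule.span ℤ ((fun s => toAdd (SurfaceGroup.abelianize g s)) ''
      ((((⊤ : Subgroup (SurfaceGroup g)).lowerCentralSeries 1) : Subgroup (SurfaceGroup g)) : Set (SurfaceGroup g))) = ⊥ := by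
    rw [Submodule.span_eq_bot]
    rintro _ ⟨s, hs, rfl⟩
    have hs' : s ∈ (SurfaceGroup.abelianize g).ker := by
      rw [SurfaceGroup.ker_abelianize_eq_lowerCentralSeries]; exact hs
    rw [MonoidHom.mem_ker] at hs'
    change toAdd (SurfaceGroup.abelianize g s) = 0
    rw [hs', toAdd_one]
  rw [h, h0, sup_bot_eq]

/-- Membership in `ker ab = γ₂` from equal abelianisations (any genus). [folklore] -/
theorem mul_inv_mem_lcs_one_of_ab_eq {s t : SurfaceGroup g}
    (h : toAdd (SurfaceGroup.abelianize g s) = toAdd (SurfaceGroup.abelianize g t)) :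
    s * t⁻¹ ∈ (⊤ : Subgroup (SurfaceGroup g)).lowerCentralSeries 1 := by
  have hk : s * t⁻¹ ∈ (SurfaceGroup.abelianize g).ker := by
    rw [MonoidHom.mem_ker, map_mul, map_inv, toAdd.injective h, mul_inv_cancel]
  rwa [SurfaceGroup.ker_abelianize_eq_lowerCentralSeries] at hk

variable {m : ℕ}

/-- If `φ` induces `F` on `H₁` and `φ(Nᵢ) = Nⱼ`, then `F(Λᵢ) = Λⱼ` (genus `3 + 3m`). [folklore] -/
theorem map_Λ_stabilizeIter_of_map_eq (φ : (SurfaceGroup (3 + 3 * m)) ≃* (SurfaceGroup (3 + 3 * m))) (F : (surfaceGen (3 + 3 * m) → ℤ) ≃ₗ[ℤ] (surfaceGen (3 + 3 * m) → ℤ))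
    (hF : ∀ s, toAdd (SurfaceGroup.abelianize (3 + 3 * m) (φ s)) = F (toAdd (SurfaceGroup.abelianize (3 + 3 * m) s)))
    {i j : Fin 3} (h : (s4Kernels.stabilizeIter m i).map φ.toMonoidHom = s4Kernels.stabilizeIter m j) :
    (Submodule.span ℤ ((fun y => (Pi.single y (1 : ℤ) : surfaceGen (3 + 3 * m) → ℤ)) '' s4CutSystem m i)).map F.toLinearMap =
      Submodule.span ℤ ((fun y => (Pi.single y (1 : ℤ) : surfaceGen (3 + 3 * m) → ℤ)) '' s4CutSystem m j) := by
  have e : Submodule.span ℤ ((fun s => toAdd (SurfaceGroup.abelianize (3 + 3 * m) s)) ''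
      (((s4Kernels.stabilizeIter m i).map φ.toMonoidHom : Subgroup (SurfaceGroup (3 + 3 * m))) : Set (SurfaceGroup (3 + 3 * m)))) =
      Submodule.span ℤ ((fun s => toAdd (SurfaceGroup.abelianize (3 + 3 * m) s)) ''
      ((s4Kernels.stabilizeIter m j : Subgroup (SurfaceGroup (3 + 3 * m))) : Set (SurfaceGroup (3 + 3 * m)))) := by rw [h]
  rw [span_image_map_g φ F hF, AbelianShadowStandard.span_image_stabilizeIter,
    AbelianShadowStandard.span_image_stabilizeIter] at e
  exact e

/-- If `φ` induces `F` on `H₁` and `φ(Nᵢ) = P` with `P γ₂ = Nᵢ γ₂`, then `F(Λᵢ) = Λᵢ` (genus `3 + 3m`). [folklore] -/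
theorem map_Λ_stabilizeIter_of_map_sup_eq (φ : (SurfaceGroup (3 + 3 * m)) ≃* (SurfaceGroup (3 + 3 * m)))
    (F : (surfaceGen (3 + 3 * m) → ℤ) ≃ₗ[ℤ] (surfaceGen (3 + 3 * m) → ℤ))
    (hF : ∀ s, toAdd (SurfaceGroup.abelianize (3 + 3 * m) (φ s)) = F (toAdd (SurfaceGroup.abelianize (3 + 3 * m) s)))
    {P : Subgroup (SurfaceGroup (3 + 3 * m))} {i : Fin 3} (h : (s4Kernels.stabilizeIter m i).map φ.toMonoidHom = P)
    (hP : P ⊔ ((⊤ : Subgroup (SurfaceGroup (3 + 3 * m))).lowerCentralSeries 1) = s4Kernels.stabilizeIter m i ⊔ ((⊤ : Subgroup (SurfaceGroup (3 + 3 * m))).lowerCentralSeries 1)) :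
    (Submodule.span ℤ ((fun y => (Pi.single y (1 : ℤ) : surfaceGen (3 + 3 * m) → ℤ)) '' s4CutSystem m i)).map F.toLinearMap =
      Submodule.span ℤ ((fun y => (Pi.single y (1 : ℤ) : surfaceGen (3 + 3 * m) → ℤ)) '' s4CutSystem m i) := by
  have e : Submodule.span ℤ ((fun s => toAdd (SurfaceGroup.abelianize (3 + 3 * m) s)) ''
      (((s4Kernels.stabilizeIter m i).map φ.toMonoidHom : Subgroup (SurfaceGroup (3 + 3 * m))) : Set (SurfaceGroup (3 + 3 * m)))) =
      Submodule.span ℤ ((fun s => toAdd (SurfaceGroup.abelianize (3 + 3 * m) s)) ''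
      ((s4Kernels.stabilizeIter m i : Subgroup (SurfaceGroup (3 + 3 * m))) : Set (SurfaceGroup (3 + 3 * m)))) := by
    rw [h, ← span_image_sup_lcs_g P, hP, span_image_sup_lcs_g]
  rw [span_image_map_g φ F hF, AbelianShadowStandard.span_image_stabilizeIter] at e
  exact e

/-- **Pair normalisation at genus `3 + 3m`.** Granted (AUTSYMP) at genus `3+3m`: if `α ∈ Stab N₀` carries `N₂` onto
`P` and `P γ₂ = N₂ γ₂`, then some IA-automorphism `α'` carries `N₂` onto `P` (`α' = α ∘ x⁻¹` for a realiser
`x ∈ Stab N₀ ∩ Stab N₂` of `ᾱ`, from the landed coordinate-pair Goeritz realisation). [folklore] -/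
theorem exists_ia_of_pair_stabilizeIter
    (hA : ∀ (φ : (SurfaceGroup (3 + 3 * m)) ≃* (SurfaceGroup (3 + 3 * m))), ∃ (F : (surfaceGen (3 + 3 * m) → ℤ) ≃ₗ[ℤ] (surfaceGen (3 + 3 * m) → ℤ)) (ε : ℤ),
      (ε = 1 ∨ ε = -1) ∧ (∀ s : (SurfaceGroup (3 + 3 * m)), toAdd (SurfaceGroup.abelianize (3 + 3 * m) (φ s)) =
        F (toAdd (SurfaceGroup.abelianize (3 + 3 * m) s))) ∧
        ∀ u v : surfaceGen (3 + 3 * m) → ℤ, symplForm (F u) (F v) = ε * symplForm u v)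
    {P : Subgroup (SurfaceGroup (3 + 3 * m))} {α : (SurfaceGroup (3 + 3 * m)) ≃* (SurfaceGroup (3 + 3 * m))}
    (hα0 : (s4Kernels.stabilizeIter m 0).map α.toMonoidHom = s4Kernels.stabilizeIter m 0)
    (hα2 : (s4Kernels.stabilizeIter m 2).map α.toMonoidHom = P)
    (hP : P ⊔ ((⊤ : Subgroup (SurfaceGroup (3 + 3 * m))).lowerCentralSeries 1) = s4Kernels.stabilizeIter m 2 ⊔ ((⊤ : Subgroup (SurfaceGroup (3 + 3 * m))).lowerCentralSeries 1)) :
    ∃ α' : (SurfaceGroup (3 + 3 * m)) ≃* (SurfaceGroup (3 + 3 * m)), (∀ s, α' s * s⁻¹ ∈ ((⊤ : Subgroup (SurfaceGroup (3 + 3 * m))).lowerCentralSeries 1)) ∧ (s4Kernels.stabilizeIter m 2).map α'.toMonoidHom = P := by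
  obtain ⟨F, ε, hε, hF, hiso⟩ := hA α
  have hΛ0 := map_Λ_stabilizeIter_of_map_eq α F hF hα0
  have hΛ2 := map_Λ_stabilizeIter_of_map_sup_eq α F hF hα2 hP
  rw [span_single_s4CutSystem] at hΛ0 hΛ2
  have h02 : ∀ j : Fin (3 + 3 * m), decide (((j : ℕ) + ((0 : Fin 3) : ℕ)) % 3 = 2) = true →
      decide (((j : ℕ) + ((2 : Fin 3) : ℕ)) % 3 = 2) = false := by
    intro j
    simp only [Fin.val_zero, Fin.val_two, decide_eq_true_eq, decide_eq_false_iff_not]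
    omega
  obtain ⟨x, hx0, hx2, hx⟩ := exists_goeritz_realises _ _ h02 F ε hε hiso
    (coords_of_map_span_eq _ F hΛ0) (coords_of_map_span_eq _ F hΛ2)
  rw [← stabilizeIter_eq_cutKernel] at hx0 hx2
  have hab_symm : ∀ s, toAdd (SurfaceGroup.abelianize (3 + 3 * m) (x.symm s)) =
      F.symm (toAdd (SurfaceGroup.abelianize (3 + 3 * m) s)) := fun s => by
    rw [eq_comm, LinearEquiv.symm_apply_eq, ← hx, MulEquiv.apply_symm_apply]
  refine ⟨x.symm.trans α, fun s => mul_inv_mem_lcs_one_of_ab_eq ?_, ?_⟩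
  · rw [MulEquiv.trans_apply, hF, hab_symm, LinearEquiv.apply_symm_apply]
  · rw [map_trans, map_symm_of_map x hx2, hα2]

end Glue

/-! ## §2 Readings through the erasing projection of slot `2` at genus `3 + 3m` -/

section Reading

variable {m : ℕ} {ct : Fin (3 + 3 * m) → Bool} {π : (SurfaceGroup (3 + 3 * m)) →* (FreeGroup (Fin (3 + 3 * m)))}

/-- The kernel `ψ(N₂)` of an automorphism `ψ` is honest: it is the kernel of `π ∘ ψ⁻¹ : S ↠ F`. [folklore] -/
theorem ker_comp_symm_g (hπker : π.ker = s4Kernels.stabilizeIter m 2) (ψ : (SurfaceGroup (3 + 3 * m)) ≃* (SurfaceGroup (3 + 3 * m))) :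
    (π.comp ψ.symm.toMonoidHom).ker = (s4Kernels.stabilizeIter m 2).map ψ.toMonoidHom := by
  rw [← MonoidHom.comap_ker, hπker, ← Subgroup.map_equiv_eq_comap_symm']

/-- An IA-automorphism moves a subgroup only within its abelian shadow. [folklore] -/
theorem map_le_sup_of_ia_g (ψ : (SurfaceGroup (3 + 3 * m)) ≃* (SurfaceGroup (3 + 3 * m))) (hψ : ∀ s : (SurfaceGroup (3 + 3 * m)), ψ s * s⁻¹ ∈ ((⊤ : Subgroup (SurfaceGroup (3 + 3 * m))).lowerCentralSeries 1)) (P : Subgroup (SurfaceGroup (3 + 3 * m))) :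
    P.map ψ.toMonoidHom ≤ P ⊔ ((⊤ : Subgroup (SurfaceGroup (3 + 3 * m))).lowerCentralSeries 1) := by
  rintro _ ⟨s, hs, rfl⟩
  have e : ψ.toMonoidHom s = (ψ s * s⁻¹) * s := by simp
  rw [e]
  exact mul_mem (mem_sup_right (hψ s)) (mem_sup_left hs)

/-- For IA `ψ`: `ψ(P) γ₂ = P γ₂`. [folklore] -/
theorem map_sup_lcs_one_of_ia_g (ψ : (SurfaceGroup (3 + 3 * m)) ≃* (SurfaceGroup (3 + 3 * m))) (hψ : ∀ s : (SurfaceGroup (3 + 3 * m)), ψ s * s⁻¹ ∈ ((⊤ : Subgroup (SurfaceGroup (3 + 3 * m))).lowerCentralSeries 1)) (P : Subgroup (SurfaceGroup (3 + 3 * m))) :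
    P.map ψ.toMonoidHom ⊔ ((⊤ : Subgroup (SurfaceGroup (3 + 3 * m))).lowerCentralSeries 1) = P ⊔ ((⊤ : Subgroup (SurfaceGroup (3 + 3 * m))).lowerCentralSeries 1) := by
  have h := ia_map_sup_lcs_one hψ P
  rw [Subgroup.map_sup, NilpotentShadowsStandard.Negative.map_lcs_top_equiv] at h
  exact h

/-- **Reading an IA-automorphism** at genus `3+3m`: the corrections `ψ(x_h) x_h⁻¹` at the cut letters of `N₂` read
through `π` as pair products of an ALTERNATING form. [folklore] -/
theorem reading_ia_g (hπs : Function.Surjective π) (hπker : π.ker = s4Kernels.stabilizeIter m 2)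
    (hπof : ∀ (h : Fin (3 + 3 * m)) (c : Bool), π (PresentedGroup.of (h, c)) = if c = ct h then 1 else FreeGroup.of h)
    (ψ : (SurfaceGroup (3 + 3 * m)) ≃* (SurfaceGroup (3 + 3 * m))) (hψ : ∀ s : (SurfaceGroup (3 + 3 * m)), ψ s * s⁻¹ ∈ ((⊤ : Subgroup (SurfaceGroup (3 + 3 * m))).lowerCentralSeries 1)) :
    ∃ D : Fin (3 + 3 * m) → Fin (3 + 3 * m) → Fin (3 + 3 * m) → ℤ,
      (∀ a b c, D b a c = -D a b c) ∧ (∀ a b c, D a c b = -D a b c) ∧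
      ∀ j : Fin (3 + 3 * m), π (ψ (PresentedGroup.of (j, ct j)) * (PresentedGroup.of (j, ct j))⁻¹) *
        (((List.finRange (3 + 3 * m)).map (fun v => ((List.finRange (3 + 3 * m)).map (fun w => if v < w then ⁅(FreeGroup.of v : FreeGroup (Fin (3 + 3 * m))), FreeGroup.of w⁆ ^ ( (if ct j then (-1 : ℤ) else 1) * D j v w ) else (1 : FreeGroup (Fin (3 + 3 * m))))).prod)).prod)⁻¹ ∈ ((⊤ : Subgroup (FreeGroup (Fin (3 + 3 * m)))).lowerCentralSeries 2) := by
  -- adapted from the landed …StubLayerStepZero (genus 3)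
  refine reading stub_magnusWittRead.2 ct π hπof ((s4Kernels.stabilizeIter m 2).map ψ.toMonoidHom)
    (π.comp ψ.symm.toMonoidHom) (hπs.comp ψ.symm.surjective) (ker_comp_symm_g hπker ψ) ?_
    (fun h => ψ (PresentedGroup.of (h, ct h)) * (PresentedGroup.of (h, ct h) : (SurfaceGroup (3 + 3 * m)))⁻¹) (fun h => hψ _) (fun h => ?_)
  · rw [hπker]; exact map_le_sup_of_ia_g ψ hψ _
  · rw [inv_mul_cancel_right]
    refine ⟨PresentedGroup.of (h, ct h), ?_, rfl⟩
    rw [SetLike.mem_coe, ← hπker, MonoidHom.mem_ker, hπof, if_pos rfl]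

/-- Pair products with zero exponents are trivial. [folklore] -/
theorem pp_zero_exp {G : Type*} [Group G] {n : ℕ} (c : Fin n → Fin n → G) :
    ((List.finRange n).map (fun v => ((List.finRange n).map (fun w =>
      if v < w then c v w ^ ((0 : ℤ)) else 1)).prod)).prod = 1 := by
  simp

/-- Pair products of central elements turn sums of exponents over a list into products. [folklore] -/
theorem pp_list_sum {G : Type*} [Group G] {n : ℕ} {ι : Type*} (c : Fin n → Fin n → G) (hc : ∀ v w, c v w ∈ center G)
    (e : ι → Fin n → Fin n → ℤ) (l : List ι) :
    ((List.finRange n).map (fun v => ((List.finRange n).map (fun w =>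
      if v < w then c v w ^ ((l.map fun i => e i v w).sum) else 1)).prod)).prod =
    (l.map fun i => ((List.finRange n).map (fun v => ((List.finRange n).map (fun w =>
      if v < w then c v w ^ (e i v w) else 1)).prod)).prod).prod := by
  induction l with
  | nil => simpa only [List.map_nil, List.sum_nil, List.prod_nil] using pp_zero_exp c
  | cons i l ih =>
    simp only [List.map_cons, List.sum_cons, List.prod_cons]
    rw [pp_add c hc, ih]

/-- **Reading a product of powers.** If the IA-automorphisms `Ψ i` read as `D i`, then for exponents `n i` the product
`∏_{i ∈ l} (Ψ i) ^ (n i)` (in `MulAut S`) is IA and reads as `∑_{i ∈ l} n i • D i`. [folklore] -/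
theorem reading_list_prod_zpow {ι : Type*} (l : List ι) (Ψ : ι → (SurfaceGroup (3 + 3 * m)) ≃* (SurfaceGroup (3 + 3 * m))) (n : ι → ℤ)
    (hΨ : ∀ i, ∀ s : (SurfaceGroup (3 + 3 * m)), Ψ i s * s⁻¹ ∈ ((⊤ : Subgroup (SurfaceGroup (3 + 3 * m))).lowerCentralSeries 1))
    (D : ι → Fin (3 + 3 * m) → Fin (3 + 3 * m) → Fin (3 + 3 * m) → ℤ)
    (hD : ∀ i (j : Fin (3 + 3 * m)), π (Ψ i (PresentedGroup.of (j, ct j)) * (PresentedGroup.of (j, ct j))⁻¹) *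
        (((List.finRange (3 + 3 * m)).map (fun v => ((List.finRange (3 + 3 * m)).map (fun w => if v < w then ⁅(FreeGroup.of v : FreeGroup (Fin (3 + 3 * m))), FreeGroup.of w⁆ ^ ( (if ct j then (-1 : ℤ) else 1) * D i j v w ) else (1 : FreeGroup (Fin (3 + 3 * m))))).prod)).prod)⁻¹ ∈ ((⊤ : Subgroup (FreeGroup (Fin (3 + 3 * m)))).lowerCentralSeries 2)) :
    (∀ s : (SurfaceGroup (3 + 3 * m)), (l.map fun i => ((Ψ i : MulAut (SurfaceGroup (3 + 3 * m))) ^ n i : MulAut (SurfaceGroup (3 + 3 * m)))).prod s * s⁻¹ ∈ ((⊤ : Subgroup (SurfaceGroup (3 + 3 * m))).lowerCentralSeries 1)) ∧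
    ∀ j : Fin (3 + 3 * m), π ((l.map fun i => ((Ψ i : MulAut (SurfaceGroup (3 + 3 * m))) ^ n i : MulAut (SurfaceGroup (3 + 3 * m)))).prod (PresentedGroup.of (j, ct j)) *
        (PresentedGroup.of (j, ct j))⁻¹) *
      (((List.finRange (3 + 3 * m)).map (fun v => ((List.finRange (3 + 3 * m)).map (fun w => if v < w then ⁅(FreeGroup.of v : FreeGroup (Fin (3 + 3 * m))), FreeGroup.of w⁆ ^ ( (if ct j then (-1 : ℤ) else 1) * (l.map fun i => n i * D i j v w).sum ) else (1 : FreeGroup (Fin (3 + 3 * m))))).prod)).prod)⁻¹ ∈ ((⊤ : Subgroup (FreeGroup (Fin (3 + 3 * m)))).lowerCentralSeries 2) := by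
  obtain ⟨h1, h2⟩ := ia_list_prod_zpow l Ψ n hΨ
  refine ⟨h1, fun j => ?_⟩
  have hle : ((⊤ : Subgroup (SurfaceGroup (3 + 3 * m))).lowerCentralSeries 2) ≤ (((⊤ : Subgroup (FreeGroup (Fin (3 + 3 * m)))).lowerCentralSeries 2)).comap π := fun s hs => map_lcs_mem π hs
  have hbar : ∀ s : (SurfaceGroup (3 + 3 * m)), (π s : (FreeGroup (Fin (3 + 3 * m))) ⧸ ((⊤ : Subgroup (FreeGroup (Fin (3 + 3 * m)))).lowerCentralSeries 2)) = QuotientGroup.map _ ((⊤ : Subgroup (FreeGroup (Fin (3 + 3 * m)))).lowerCentralSeries 2) π hle (s : (SurfaceGroup (3 + 3 * m) ⧸ (⊤ : Subgroup (SurfaceGroup (3 + 3 * m))).lowerCentralSeries 2)) := fun s => rfl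
  have hcen : ∀ v w : Fin (3 + 3 * m), (QuotientGroup.mk' ((⊤ : Subgroup (FreeGroup (Fin (3 + 3 * m)))).lowerCentralSeries 2)) ⁅(FreeGroup.of v : (FreeGroup (Fin (3 + 3 * m)))), FreeGroup.of w⁆ ∈
      center ((FreeGroup (Fin (3 + 3 * m))) ⧸ ((⊤ : Subgroup (FreeGroup (Fin (3 + 3 * m)))).lowerCentralSeries 2)) := fun v w => by
    rw [map_commutatorElement]; exact quot_commutator_mem_center _ _
  rw [mul_inv_mem_iff_quot, hbar, h2, map_list_prod, List.map_map]
  have hterm : ∀ i, ((QuotientGroup.map _ ((⊤ : Subgroup (FreeGroup (Fin (3 + 3 * m)))).lowerCentralSeries 2) π hle) ∘ fun i =>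
      (((Ψ i (PresentedGroup.of (j, ct j)) * (PresentedGroup.of (j, ct j))⁻¹ : (SurfaceGroup (3 + 3 * m))) : (SurfaceGroup (3 + 3 * m) ⧸ (⊤ : Subgroup (SurfaceGroup (3 + 3 * m))).lowerCentralSeries 2)) ^ n i)) i =
      (QuotientGroup.mk' ((⊤ : Subgroup (FreeGroup (Fin (3 + 3 * m)))).lowerCentralSeries 2)) (((List.finRange (3 + 3 * m)).map (fun v => ((List.finRange (3 + 3 * m)).map (fun w => if v < w then ⁅(FreeGroup.of v : FreeGroup (Fin (3 + 3 * m))), FreeGroup.of w⁆ ^ ( (if ct j then (-1 : ℤ) else 1) * (n i * D i j v w) ) else (1 : FreeGroup (Fin (3 + 3 * m))))).prod)).prod) := by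
    intro i
    rw [Function.comp_apply, map_zpow, ← hbar, (mul_inv_mem_iff_quot _ _ _).1 (hD i j), ← QuotientGroup.mk'_apply,
      pp_map, pp_zpow_of_central _ hcen, ← pp_map]
    exact congrArg _ (pp_congr _ _ _ _ fun v w _ => by rw [mul_left_comm])
  have hprod : (l.map fun i => (QuotientGroup.mk' ((⊤ : Subgroup (FreeGroup (Fin (3 + 3 * m)))).lowerCentralSeries 2)) (((List.finRange (3 + 3 * m)).map (fun v => ((List.finRange (3 + 3 * m)).map (fun w => if v < w then ⁅(FreeGroup.of v : FreeGroup (Fin (3 + 3 * m))), FreeGroup.of w⁆ ^ ( (if ct j then (-1 : ℤ) else 1) * (n i * D i j v w) ) else (1 : FreeGroup (Fin (3 + 3 * m))))).prod)).prod)).prod =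
      (QuotientGroup.mk' ((⊤ : Subgroup (FreeGroup (Fin (3 + 3 * m)))).lowerCentralSeries 2)) (((List.finRange (3 + 3 * m)).map (fun v => ((List.finRange (3 + 3 * m)).map (fun w => if v < w then ⁅(FreeGroup.of v : FreeGroup (Fin (3 + 3 * m))), FreeGroup.of w⁆ ^ ( (l.map fun i => (if ct j then (-1 : ℤ) else 1) * (n i * D i j v w)).sum ) else (1 : FreeGroup (Fin (3 + 3 * m))))).prod)).prod) := by
    have key := pp_list_sum (fun v w => (QuotientGroup.mk' ((⊤ : Subgroup (FreeGroup (Fin (3 + 3 * m)))).lowerCentralSeries 2)) ⁅(FreeGroup.of v : (FreeGroup (Fin (3 + 3 * m)))), FreeGroup.of w⁆) hcen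
      (fun i v w => (if ct j then (-1 : ℤ) else 1) * (n i * D i j v w)) l
    rw [pp_map, key]
    exact congrArg List.prod (List.map_congr_left fun i _ => by rw [pp_map])
  rw [List.map_congr_left fun i _ => hterm i, hprod, ← QuotientGroup.mk'_apply]
  congr 1
  exact pp_congr _ _ _ _ fun v w _ => by rw [List.sum_map_mul_left]

/-- **Equal readings on `v < w` give equal level-two shadows (one inclusion)**, genus `3+3m`. [folklore] -/
theorem map_le_of_forms_g (hct : ∀ (h : Fin (3 + 3 * m)) (c : Bool), ((h, c) ∈ s4CutSystem m 2 ↔ c = ct h))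
    (hπs : Function.Surjective π) (hπker : π.ker = s4Kernels.stabilizeIter m 2)
    (hπof : ∀ (h : Fin (3 + 3 * m)) (c : Bool), π (PresentedGroup.of (h, c)) = if c = ct h then 1 else FreeGroup.of h)
    (ψ φ : (SurfaceGroup (3 + 3 * m)) ≃* (SurfaceGroup (3 + 3 * m))) (hψ : ∀ s : (SurfaceGroup (3 + 3 * m)), ψ s * s⁻¹ ∈ ((⊤ : Subgroup (SurfaceGroup (3 + 3 * m))).lowerCentralSeries 1)) (hφ : ∀ s : (SurfaceGroup (3 + 3 * m)), φ s * s⁻¹ ∈ ((⊤ : Subgroup (SurfaceGroup (3 + 3 * m))).lowerCentralSeries 1))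
    (D D' : Fin (3 + 3 * m) → Fin (3 + 3 * m) → Fin (3 + 3 * m) → ℤ)
    (hD : ∀ j : Fin (3 + 3 * m), π (ψ (PresentedGroup.of (j, ct j)) * (PresentedGroup.of (j, ct j))⁻¹) *
        (((List.finRange (3 + 3 * m)).map (fun v => ((List.finRange (3 + 3 * m)).map (fun w => if v < w then ⁅(FreeGroup.of v : FreeGroup (Fin (3 + 3 * m))), FreeGroup.of w⁆ ^ ( (if ct j then (-1 : ℤ) else 1) * D j v w ) else (1 : FreeGroup (Fin (3 + 3 * m))))).prod)).prod)⁻¹ ∈ ((⊤ : Subgroup (FreeGroup (Fin (3 + 3 * m)))).lowerCentralSeries 2))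
    (hD' : ∀ j : Fin (3 + 3 * m), π (φ (PresentedGroup.of (j, ct j)) * (PresentedGroup.of (j, ct j))⁻¹) *
        (((List.finRange (3 + 3 * m)).map (fun v => ((List.finRange (3 + 3 * m)).map (fun w => if v < w then ⁅(FreeGroup.of v : FreeGroup (Fin (3 + 3 * m))), FreeGroup.of w⁆ ^ ( (if ct j then (-1 : ℤ) else 1) * D' j v w ) else (1 : FreeGroup (Fin (3 + 3 * m))))).prod)).prod)⁻¹ ∈ ((⊤ : Subgroup (FreeGroup (Fin (3 + 3 * m)))).lowerCentralSeries 2))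
    (heq : ∀ j v w : Fin (3 + 3 * m), v < w → D j v w = D' j v w) :
    (s4Kernels.stabilizeIter m 2).map ψ.toMonoidHom ≤
      (s4Kernels.stabilizeIter m 2).map φ.toMonoidHom ⊔ ((⊤ : Subgroup (SurfaceGroup (3 + 3 * m))).lowerCentralSeries 2) := by
  -- adapted from the landed …StubLayerStepZero (genus 3)
  haveI hPn : (s4Kernels.stabilizeIter m 2).Normal := by rw [← hπker]; infer_instance
  haveI hQn : ((s4Kernels.stabilizeIter m 2).map φ.toMonoidHom).Normal := Subgroup.Normal.map hPn _ φ.surjective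
  have hQfree : IsFreeOfRank ((SurfaceGroup (3 + 3 * m)) ⧸ (s4Kernels.stabilizeIter m 2).map φ.toMonoidHom) (3 + 3 * m) :=
    (isFreeOfRank_quotient_ker (π.comp φ.symm.toMonoidHom) (hπs.comp φ.symm.surjective)).of_mulEquiv
      (QuotientGroup.quotientMulEquivOfEq (ker_comp_symm_g hπker φ))
  have hQnhd := stub_noHiddenDepth (3 + 3 * m) (3 + 3 * m) ((s4Kernels.stabilizeIter m 2).map φ.toMonoidHom) hQfree
  have hπnhd : π.ker ⊓ ((⊤ : Subgroup (SurfaceGroup (3 + 3 * m))).lowerCentralSeries 1) ≤ ⁅π.ker, (⊤ : Subgroup (SurfaceGroup (3 + 3 * m)))⁆ :=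
    stub_noHiddenDepth (3 + 3 * m) (3 + 3 * m) π.ker (isFreeOfRank_quotient_ker π hπs)
  have hQP : (s4Kernels.stabilizeIter m 2).map φ.toMonoidHom ⊔ ((⊤ : Subgroup (SurfaceGroup (3 + 3 * m))).lowerCentralSeries 1) = s4Kernels.stabilizeIter m 2 ⊔ ((⊤ : Subgroup (SurfaceGroup (3 + 3 * m))).lowerCentralSeries 1) :=
    map_sup_lcs_one_of_ia_g φ hφ _
  have hN2 : (s4Kernels.stabilizeIter m 2 : Subgroup (SurfaceGroup (3 + 3 * m))) = normalClosure (PresentedGroup.of '' s4CutSystem m 2) :=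
    stub_cutNormalForm m 2
  conv_lhs => rw [hN2, Subgroup.map_normalClosure _ _ ψ.surjective]
  refine normalClosure_le_normal ?_
  rintro _ ⟨_, ⟨⟨j, c⟩, hx, rfl⟩, rfl⟩
  obtain rfl : c = ct j := (hct j c).1 hx
  rw [SetLike.mem_coe, MulEquiv.coe_toMonoidHom]
  refine (level_mem_iff 0 ((s4Kernels.stabilizeIter m 2).map φ.toMonoidHom) (s4Kernels.stabilizeIter m 2) hQnhd hQP
    (u := φ (PresentedGroup.of (j, ct j) : (SurfaceGroup (3 + 3 * m))) * (PresentedGroup.of (j, ct j) : (SurfaceGroup (3 + 3 * m)))⁻¹)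
    (x := (PresentedGroup.of (j, ct j) : (SurfaceGroup (3 + 3 * m)))) (y := ψ (PresentedGroup.of (j, ct j) : (SurfaceGroup (3 + 3 * m)))) ?_ (hψ _) (hφ _)).2 ?_
  · rw [inv_mul_cancel_right]
    exact ⟨_, by rw [SetLike.mem_coe, ← hπker, MonoidHom.mem_ker, hπof, if_pos rfl], rfl⟩
  · rw [← hπker]
    refine mem_commutator_sup_of_map_mem π hπs hπnhd (mul_mem (hψ _) (inv_mem (hφ _))) ?_
    have e : ∀ a b c : (FreeGroup (Fin (3 + 3 * m))), a * b⁻¹ = (a * c⁻¹) * (b * c⁻¹)⁻¹ := fun a b c => by group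
    rw [map_mul, map_inv, e _ _ (((List.finRange (3 + 3 * m)).map (fun v => ((List.finRange (3 + 3 * m)).map (fun w => if v < w then ⁅(FreeGroup.of v : FreeGroup (Fin (3 + 3 * m))), FreeGroup.of w⁆ ^ ( (if ct j then (-1 : ℤ) else 1) * D j v w ) else (1 : FreeGroup (Fin (3 + 3 * m))))).prod)).prod)]
    refine mul_mem (hD j) (inv_mem ?_)
    have hpp : (((List.finRange (3 + 3 * m)).map (fun v => ((List.finRange (3 + 3 * m)).map (fun w => if v < w then ⁅(FreeGroup.of v : FreeGroup (Fin (3 + 3 * m))), FreeGroup.of w⁆ ^ ( (if ct j then (-1 : ℤ) else 1) * D j v w ) else (1 : FreeGroup (Fin (3 + 3 * m))))).prod)).prod) = (((List.finRange (3 + 3 * m)).map (fun v => ((List.finRange (3 + 3 * m)).map (fun w => if v < w then ⁅(FreeGroup.of v : FreeGroup (Fin (3 + 3 * m))), FreeGroup.of w⁆ ^ ( (if ct j then (-1 : ℤ) else 1) * D' j v w ) else (1 : FreeGroup (Fin (3 + 3 * m))))).prod)).prod) :=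
      pp_congr _ _ _ _ fun v w hvw => by rw [heq j v w hvw]
    rw [hpp]
    exact hD' j

/-- **Equal readings on `v < w` give equal level-two shadows**: `ψ(N₂) γ₃ = φ(N₂) γ₃`. [folklore] -/
theorem map_sup_eq_of_forms_g (hct : ∀ (h : Fin (3 + 3 * m)) (c : Bool), ((h, c) ∈ s4CutSystem m 2 ↔ c = ct h))
    (hπs : Function.Surjective π) (hπker : π.ker = s4Kernels.stabilizeIter m 2)
    (hπof : ∀ (h : Fin (3 + 3 * m)) (c : Bool), π (PresentedGroup.of (h, c)) = if c = ct h then 1 else FreeGroup.of h)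
    (ψ φ : (SurfaceGroup (3 + 3 * m)) ≃* (SurfaceGroup (3 + 3 * m))) (hψ : ∀ s : (SurfaceGroup (3 + 3 * m)), ψ s * s⁻¹ ∈ ((⊤ : Subgroup (SurfaceGroup (3 + 3 * m))).lowerCentralSeries 1)) (hφ : ∀ s : (SurfaceGroup (3 + 3 * m)), φ s * s⁻¹ ∈ ((⊤ : Subgroup (SurfaceGroup (3 + 3 * m))).lowerCentralSeries 1))
    (D D' : Fin (3 + 3 * m) → Fin (3 + 3 * m) → Fin (3 + 3 * m) → ℤ)
    (hD : ∀ j : Fin (3 + 3 * m), π (ψ (PresentedGroup.of (j, ct j)) * (PresentedGroup.of (j, ct j))⁻¹) *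
        (((List.finRange (3 + 3 * m)).map (fun v => ((List.finRange (3 + 3 * m)).map (fun w => if v < w then ⁅(FreeGroup.of v : FreeGroup (Fin (3 + 3 * m))), FreeGroup.of w⁆ ^ ( (if ct j then (-1 : ℤ) else 1) * D j v w ) else (1 : FreeGroup (Fin (3 + 3 * m))))).prod)).prod)⁻¹ ∈ ((⊤ : Subgroup (FreeGroup (Fin (3 + 3 * m)))).lowerCentralSeries 2))
    (hD' : ∀ j : Fin (3 + 3 * m), π (φ (PresentedGroup.of (j, ct j)) * (PresentedGroup.of (j, ct j))⁻¹) *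
        (((List.finRange (3 + 3 * m)).map (fun v => ((List.finRange (3 + 3 * m)).map (fun w => if v < w then ⁅(FreeGroup.of v : FreeGroup (Fin (3 + 3 * m))), FreeGroup.of w⁆ ^ ( (if ct j then (-1 : ℤ) else 1) * D' j v w ) else (1 : FreeGroup (Fin (3 + 3 * m))))).prod)).prod)⁻¹ ∈ ((⊤ : Subgroup (FreeGroup (Fin (3 + 3 * m)))).lowerCentralSeries 2))
    (heq : ∀ j v w : Fin (3 + 3 * m), v < w → D j v w = D' j v w) :
    ((s4Kernels.stabilizeIter m 2) ⊔ ((⊤ : Subgroup (SurfaceGroup (3 + 3 * m))).lowerCentralSeries 2)).map ψ.toMonoidHom =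
      (s4Kernels.stabilizeIter m 2).map φ.toMonoidHom ⊔ ((⊤ : Subgroup (SurfaceGroup (3 + 3 * m))).lowerCentralSeries 2) := by
  have hle₁ := map_le_of_forms_g hct hπs hπker hπof ψ φ hψ hφ D D' hD hD' heq
  have hle₂ := map_le_of_forms_g hct hπs hπker hπof φ ψ hφ hψ D' D hD' hD (fun j v w h => (heq j v w h).symm)
  rw [Subgroup.map_sup, NilpotentShadowsStandard.Negative.map_lcs_top_equiv]
  refine le_antisymm (sup_le hle₁ le_sup_right) (sup_le ?_ le_sup_right)
  calc (s4Kernels.stabilizeIter m 2).map φ.toMonoidHom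
      ≤ (s4Kernels.stabilizeIter m 2).map ψ.toMonoidHom ⊔ ((⊤ : Subgroup (SurfaceGroup (3 + 3 * m))).lowerCentralSeries 2) := hle₂
    _ ≤ _ := le_rfl

end Reading

/-! ## Registered helper -/

/-- **Registered helper `helper_pairNormalisationGen`** (sub-goal of stub `stub_layerStepOneZero`, crux
stmt-SmoothPoincare4-14595): pair normalisation at every genus `3 + 3m`, in closed form — given (AUTSYMP) at genus
`3+3m`, an `α ∈ Stab N₀` with `α(N₂) = P`, `P γ₂ = N₂ γ₂` is replaced by an IA-automorphism carrying `N₂` onto `P`.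
[folklore] -/
theorem helper_pairNormalisationGen : ∀ (m : ℕ), (∀ (φ : SurfaceGroup (3 + 3 * m) ≃* SurfaceGroup (3 + 3 * m)), ∃ (F : (surfaceGen (3 + 3 * m) → ℤ) ≃ₗ[ℤ] (surfaceGen (3 + 3 * m) → ℤ)) (ε : ℤ), (ε = 1 ∨ ε = -1) ∧ (∀ s : SurfaceGroup (3 + 3 * m), toAdd (SurfaceGroup.abelianize (3 + 3 * m) (φ s)) = F (toAdd (SurfaceGroup.abelianize (3 + 3 * m) s))) ∧ ∀ u v : surfaceGen (3 + 3 * m) → ℤ, symplForm (F u) (F v) = ε * symplForm u v) → ∀ (P : Subgroup (SurfaceGroup (3 + 3 * m))) (α : SurfaceGroup (3 + 3 * m) ≃* SurfaceGroup (3 + 3 * m)), (s4Kernels.stabilizeIter m 0).map α.toMonoidHom = s4Kernels.stabilizeIter m 0 → (s4Kernels.stabilizeIter m 2).map α.toMonoidHom = P → P ⊔ (⊤ : Subgroup (SurfaceGroup (3 + 3 * m))).lowerCentralSeries 1 = s4Kernels.stabilizeIter m 2 ⊔ (⊤ : Subgroup (SurfaceGroup (3 + 3 * m))).lowerCentralSeries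 1 → ∃ α' : SurfaceGroup (3 + 3 * m) ≃* SurfaceGroup (3 + 3 * m), (∀ s : SurfaceGroup (3 + 3 * m), α' s * s⁻¹ ∈ (⊤ : Subgroup (SurfaceGroup (3 + 3 * m))).lowerCentralSeries 1) ∧ (s4Kernels.stabilizeIter m 2).map α'.toMonoidHom = P :=
  fun _ hA _ _ hα0 hα2 hP => exists_ia_of_pair_stabilizeIter hA hα0 hα2 hP

end Summit.SmoothPoincare4.SmoothPoincare4.Theorems.ShadowApproximation.NilpotentGenusClass

end
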